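import Summits.CriticalPhenomena.CardyFormulaZ2.Theorems.CardyBoundaryCoulombGasRectilinearCardyStubPointwiseFromEngineGPart1
import Summits.CriticalPhenomena.CardyFormulaZ2.Theorems.CardyBoundaryCoulombGasRectilinearCardyStubConjGeometry
import Summits.CriticalPhenomena.CardyFormulaZ2.Theorems.CardyBoundaryCoulombGasRectilinearCardyStubOrientation
import Summits.CriticalPhenomena.CardyFormulaZ2.Theorems.CardyBoundaryCoulombGasRectilinearCardyStubConjDensity
import HarnessLib

/-!
# Stub A2′ of line excursion-kernel-covariance (crux RectilinearCardy, stmt-CriticalPhenomena-5660): the route's engine and the lattice bridge give the pointwise closure-density law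

Lead `prover-line-stmt-CriticalPhenomena-5660-c3-0`, reshape c3-1 of the skeleton
`Cruxes/RectilinearCardy/Lines/excursion_kernel_covariance.lean`. The registered stub
`stub_pointwiseFromEngineG : BoundaryDefectGaussianR → LatticeBridge → PointwiseDensityLawG` (all
inlined): the route's engine crux (stmt-14132) and the line's lattice bridge (the Baxter–Kelland–Wu
dictionary in use: placements of the `(1,3,1,1; sink 1)` datum along the boundary row of the closure
polygon whose insertion ratio `‖Zins‖/‖Z‖` is the closure density up to `o(δ)`) give the POINTWISE
CLOSURE-DENSITY LAW for charts of the Schwarz class: `closureDensity R δ_n v_n / δ_n → C Φ_w(x)` along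
boundary-row vertices `δ_n v_n → x = ∂Ω(τ)`, `Φ_w(x) = |w′(x)| (∏_{p=a,b,d} |w(x) - w(p)|²)^{-1/3}`.

Proof (composition of the landed analytic stubs of wave 1):
* `stub_orientation` decides the orientation of the boundary loop at the flat mark `a` and matches it
  with the monotonicity of the chart's boundary function `g` (`Re (w′ u) ≥ 0` on the left);
* CLOCKWISE (`pointwise_cw`): the engine's `(1,3,1,1; 1)` member (charges `(1,-2,1,1)`, `Σ h = 1`) is
  applied to the REVERSED mark-inserted marked domain `(Ω; d, ∂Ω(τ), b, a)` (`stub_reverseInsert`),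
  which is counter-clockwise, so the chart's boundary values increase along it near every mark
  (`strictMonoOn_re_reversed`); the bridge's placements are shifted to be injective and admissible
  from the start; the engine's limit is read through `stub_chartAlgebra` ((b): closed form
  `C₀ K Φ_w(x)`, `K = (|w d - w b| |w d - w a| |w b - w a|)^{1/3}`; (c): normalisation `δ⁻¹`), and the
  bridge's `o(δ)` comparison transfers it to `closureDensity / δ`;
* COUNTER-CLOCKWISE: the configuration is reflected by complex conjugation — the conjugate copy `R'`
  (`stub_conjGeometry`: rectilinear, flat marks, admissible windows, boundary row, now clockwise at
  `a`) with the conjugate chart `z ↦ -conj (w (conj z))` (`stub_chartAlgebra` (a)), whose boundary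
  function `-g` decreases; `pointwise_cw` applies to it, and the conclusion is carried back by the
  reflection-invariance of the closure density (`stub_conjDensity`) and of the profile
  (`‖deriv‖`, `‖w x - w p‖` are conjugation-invariant).
Sources: Baxter–Kelland–Wu 1976 §3–4 (collar / leg insertions); the line card
`Cruxes/RectilinearCardy/Lines/excursion-kernel-covariance.md`; lead notes `Cruxes/RectilinearCardy/PICKED.md` (c3).
-/

noncomputable section

open Set Filter Topology MeasureTheory Metric
open Literature.Probability.RandomPlanarGeometry
open Literature.Probability.LatticeModels (Site meshPoint zdGraph)
open Summit.CriticalPhenomena.CardyFormulaZ2.Theorems.RectilinearCardy.Negative (IsRectilinear)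
open Summit.CriticalPhenomena.CardyFormulaZ2.Theses.CardyBoundaryCoulombGas (BoundaryDefectGaussianR)
open Literature.Probability.LatticeModels.CollarLegModel (LegInsertionData Zins ofDomain)

namespace Summit.CriticalPhenomena.CardyFormulaZ2.Cruxes.RectilinearCardy.ExcursionKernelCovariance

/-! ### The registered stub: orientation split, reflection of the counter-clockwise case -/

/-- **Stub A2′ of line excursion-kernel-covariance** (registered signature, verbatim): the engine and the
lattice bridge give the pointwise closure-density law for the Schwarz-chart class. Decide the
orientation at the flat mark `a` (`stub_orientation`) and match it with the monotonicity of the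
chart's boundary function; clockwise: `pointwise_cw`; counter-clockwise: reflect the configuration
by complex conjugation (`stub_conjGeometry`, conjugate chart `z ↦ -conj (w (conj z))` by
`stub_chartAlgebra` (a)), apply `pointwise_cw` to the conjugate copy, and carry the conclusion back
with the reflection-invariance of the closure density (`stub_conjDensity`) and of the profile. [cite: BaxterKellandWu1976, §3–§4] -/
theorem stub_pointwiseFromEngineG :
    BoundaryDefectGaussianR →
    (∀ R : ConformalRectangle, IsRectilinear R → FlatMarks R →
      (∃ u : ℂ, (u = 1 ∨ u = Complex.I ∨ u = -1 ∨ u = -Complex.I) ∧ ∃ r : ℝ, 0 < r ∧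
        (∀ t t' : ℝ, R.mark 0 - r < t → t < t' → t' < R.mark 0 + r →
          0 < ((R.boundary t' - R.boundary t) / u).re ∧ ((R.boundary t' - R.boundary t) / u).im = 0) ∧
        (∀ z : ℂ, dist z (R.pt 0) < r →
          (z ∈ R.carrier ↔ 0 < -((z - R.pt 0) / u).im))) →
      ∀ σ σ' : ℝ, AdmissibleRange R σ σ' → ∀ τ ∈ Icc σ σ',
        ∀ (δ : ℕ → ℝ), (∀ n, 0 < δ n) → Tendsto δ atTop (𝓝 0) →
        ∀ (v : ℕ → Site 2), (∀ n, v n ∈ boundaryRow R (δ n)) →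
          Tendsto (fun n => meshPoint (δ n) (v n)) atTop (𝓝 (R.boundary τ)) →
          ∃ p : ℕ → Fin 4 → ℤ × ℤ,
            (∀ i : Fin 4, Tendsto (fun n => ((p n i).1 : ℂ) * δ n + ((p n i).2 : ℂ) * δ n * Complex.I)
              atTop (𝓝 ((![R.pt 3, R.boundary τ, R.pt 1, R.pt 0] : Fin 4 → ℂ) i))) ∧
            (∀ᶠ n in atTop, Function.Injective (p n) ∧
              LegInsertionData.IsAdmissible
                (⟨(Finset.univ.erase 1).image (p n),
                  fun x ↦ ∑ i ∈ (Finset.univ.erase 1).filter (fun i ↦ p n i = x),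
                    (![1, 3, 1, 1] : Fin 4 → ℕ) i, p n 1⟩ : LegInsertionData)
                ((closureFinset R (δ n)).image fun x : Site 2 => (x 0, x 1))) ∧
            ∀ ε : ℝ, 0 < ε → ∀ᶠ n in atTop,
              |‖Zins ((closureFinset R (δ n)).image fun x : Site 2 => (x 0, x 1))
                  (⟨(Finset.univ.erase 1).image (p n),
                    fun x ↦ ∑ i ∈ (Finset.univ.erase 1).filter (fun i ↦ p n i = x),
                      (![1, 3, 1, 1] : Fin 4 → ℕ) i, p n 1⟩ : LegInsertionData)‖ /
                  ‖(ofDomain ((closureFinset R (δ n)).image fun x : Site 2 => (x 0, x 1))).Z‖ -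
                closureDensity R (δ n) (v n)| ≤ ε * δ n) →
    ∀ R : ConformalRectangle, IsRectilinear R → FlatMarks R →
      ∀ (U : Set ℂ) (w : ℂ → ℂ), IsOpen U → R.carrier ⊆ U →
        R.pt 0 ∈ U → R.pt 1 ∈ U → R.pt 3 ∈ U →
        DifferentiableOn ℂ w U → BijOn w R.carrier {z : ℂ | 0 < z.im} →
        ∀ (g : ℝ → ℝ) (S₀ S : ℝ), S₀ < 0 → R.mark 3 < S →
          (StrictMonoOn g (Icc S₀ S) ∨ StrictAntiOn g (Icc S₀ S)) →
          (∀ t ∈ Icc S₀ S, R.boundary t ∈ U → w (R.boundary t) = g t) →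
        ∃ C : ℝ, 0 < C ∧
          ∀ σ σ' : ℝ, AdmissibleRange R σ σ' → R.boundary '' Icc σ σ' ⊆ U →
            (∀ τ ∈ Icc σ σ', w (R.boundary τ) ≠ w (R.pt 0) ∧ w (R.boundary τ) ≠ w (R.pt 1) ∧
              w (R.boundary τ) ≠ w (R.pt 3)) →
            ∀ τ ∈ Icc σ σ', ∀ (δ : ℕ → ℝ), (∀ n, 0 < δ n) → Tendsto δ atTop (𝓝 0) →
              ∀ (v : ℕ → Site 2), (∀ n, v n ∈ boundaryRow R (δ n)) →
                Tendsto (fun n => meshPoint (δ n) (v n)) atTop (𝓝 (R.boundary τ)) →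
                Tendsto (fun n => closureDensity R (δ n) (v n) / δ n) atTop
                  (𝓝 (C * (‖deriv w (R.boundary τ)‖ *
                    (‖w (R.boundary τ) - w (R.pt 0)‖ ^ 2 * ‖w (R.boundary τ) - w (R.pt 1)‖ ^ 2 *
                        ‖w (R.boundary τ) - w (R.pt 3)‖ ^ 2) ^ (-(1 / 3 : ℝ))))) := by
  intro hE hL R hR hF U w hUo hΩU h0U h1U h3U hwd hwbij g S₀ S hS₀ h3S hgm hwg
  have hm0 : 0 ≤ R.mark 0 := (R.mark_mem 0).1
  have hm03 : R.mark 0 < R.mark 3 := R.strictMono_mark (show (0 : Fin 4) < 3 by decide)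
  obtain ⟨b, hOb, hmatch⟩ := stub_orientation R hF
  have hm := hmatch U w g S₀ S hUo h0U hwd hwbij.mapsTo (by linarith) (by linarith) hwg hgm
  cases b with
  | true =>
    -- clockwise: `g` decreases; apply the core directly
    obtain ⟨u, hu, r, hr, hdir, hside⟩ := hOb
    exact pointwise_cw hE hL R hR hF ⟨u, hu, r, hr, hdir, fun z hz => by simpa using hside z hz⟩ U w
      hUo hΩU h0U h1U h3U hwd hwbij g S₀ S hS₀ h3S (hm.2 rfl) hwg
  | false =>
    -- counter-clockwise: `g` increases; reflect by complex conjugation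
    have hgm' : StrictMonoOn g (Icc S₀ S) := hm.1 rfl
    obtain ⟨hGex, hGtr⟩ := stub_conjGeometry
    obtain ⟨R', hR'⟩ := hGex R
    obtain ⟨hcar, hbdy, hmark⟩ := hR'
    obtain ⟨hrect', hflat', hadm', horient', hrow'⟩ := hGtr R R' ⟨hcar, hbdy, hmark⟩
    obtain ⟨hXa, -, -⟩ := stub_chartAlgebra
    obtain ⟨hU'o, hw'd, hw'deriv, hw'bij⟩ := hXa U w hUo hwd
    -- the conjugate data
    set U' : Set ℂ := {z : ℂ | (starRingEnd ℂ) z ∈ U} with hU'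
    set w' : ℂ → ℂ := fun z => -(starRingEnd ℂ) (w ((starRingEnd ℂ) z)) with hw'
    have hcarrier : R'.carrier = {z : ℂ | (starRingEnd ℂ) z ∈ R.carrier} := Set.ext hcar
    have hpt' : ∀ i, R'.pt i = (starRingEnd ℂ) (R.pt i) := fun i => by
      show R'.boundary (R'.mark i) = _
      rw [hbdy, hmark]; rfl
    have hΩU' : R'.carrier ⊆ U' := fun z hz => hΩU ((hcar z).1 hz)
    have hptU' : ∀ i, R.pt i ∈ U → R'.pt i ∈ U' := fun i hi => by
      show (starRingEnd ℂ) (R'.pt i) ∈ U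
      rw [hpt', Complex.conj_conj]; exact hi
    have hw'bijR : BijOn w' R'.carrier {z : ℂ | 0 < z.im} := by
      rw [hcarrier]; exact hw'bij R.carrier hwbij
    have hg' : StrictAntiOn (fun t => -g t) (Icc S₀ S) := fun a ha b hb hab =>
      neg_lt_neg (hgm' ha hb hab)
    have hwg' : ∀ t ∈ Icc S₀ S, R'.boundary t ∈ U' → w' (R'.boundary t) = ((fun t => -g t) t : ℝ) := by
      intro t ht htU
      have htU0 : R.boundary t ∈ U := by
        have : (starRingEnd ℂ) (R'.boundary t) ∈ U := htU
        rwa [hbdy, Complex.conj_conj] at this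
      show -(starRingEnd ℂ) (w ((starRingEnd ℂ) (R'.boundary t))) = ((-g t : ℝ) : ℂ)
      rw [hbdy, Complex.conj_conj, hwg t ht htU0, Complex.conj_ofReal, Complex.ofReal_neg]
    have horR' : ∃ u : ℂ, (u = 1 ∨ u = Complex.I ∨ u = -1 ∨ u = -Complex.I) ∧ ∃ r : ℝ, 0 < r ∧
        (∀ t t' : ℝ, R'.mark 0 - r < t → t < t' → t' < R'.mark 0 + r →
          0 < ((R'.boundary t' - R'.boundary t) / u).re ∧ ((R'.boundary t' - R'.boundary t) / u).im = 0) ∧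
        (∀ z : ℂ, dist z (R'.pt 0) < r → (z ∈ R'.carrier ↔ 0 < -((z - R'.pt 0) / u).im)) := by
      obtain ⟨u, hu, r, hr, hdir, hside⟩ := hOb
      exact horient' ⟨u, hu, r, hr, hdir, fun z hz => by simpa using hside z hz⟩
    have h3S' : R'.mark 3 < S := by rw [hmark]; exact h3S
    obtain ⟨C, hC, hmain⟩ := pointwise_cw hE hL R' (hrect' hR) (hflat' hF) horR' U' w' hU'o hΩU'
      (hptU' 0 h0U) (hptU' 1 h1U) (hptU' 3 h3U) hw'd hw'bijR (fun t => -g t) S₀ S hS₀ h3S' hg' hwg'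
    refine ⟨C, hC, fun σ σ' hadm hwinU hsep τ hτ δ hδ hδ0 v hv hvx => ?_⟩
    -- the conjugate window data
    have hwinU' : R'.boundary '' Icc σ σ' ⊆ U' := by
      rintro _ ⟨t, ht, rfl⟩
      show (starRingEnd ℂ) (R'.boundary t) ∈ U
      rw [hbdy, Complex.conj_conj]
      exact hwinU ⟨t, ht, rfl⟩
    have hval' : ∀ t, w' (R'.boundary t) = -(starRingEnd ℂ) (w (R.boundary t)) := fun t => by
      show -(starRingEnd ℂ) (w ((starRingEnd ℂ) (R'.boundary t))) = _
      rw [hbdy, Complex.conj_conj]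
    have hvalpt' : ∀ i, w' (R'.pt i) = -(starRingEnd ℂ) (w (R.pt i)) := fun i => by
      show w' (R'.boundary (R'.mark i)) = _
      rw [hval', hmark]; rfl
    have hsep' : ∀ t ∈ Icc σ σ', w' (R'.boundary t) ≠ w' (R'.pt 0) ∧ w' (R'.boundary t) ≠ w' (R'.pt 1) ∧
        w' (R'.boundary t) ≠ w' (R'.pt 3) := by
      intro t ht
      obtain ⟨h0, h1, h3⟩ := hsep t ht
      rw [hval', hvalpt', hvalpt', hvalpt']
      refine ⟨fun h => h0 ?_, fun h => h1 ?_, fun h => h3 ?_⟩ <;>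
        simpa using congrArg (starRingEnd ℂ) (neg_injective h)
    -- the reflected vertices
    have hv' : ∀ n, (![v n 0, -v n 1] : Site 2) ∈ boundaryRow R' (δ n) := fun n => hrow' _ _ (hv n)
    have hmesh : ∀ (δ : ℝ) (x : Site 2), meshPoint δ (![x 0, -x 1] : Site 2) = (starRingEnd ℂ) (meshPoint δ x) := by
      intro δ x
      apply Complex.ext <;> simp [Literature.Probability.LatticeModels.meshPoint_re,
        Literature.Probability.LatticeModels.meshPoint_im]
    have hvx' : Tendsto (fun n => meshPoint (δ n) (![v n 0, -v n 1] : Site 2)) atTop (𝓝 (R'.boundary τ)) := by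
      rw [hbdy]
      simp_rw [hmesh]
      exact (Complex.continuous_conj.tendsto _).comp hvx
    have key := hmain σ σ' (hadm' σ σ' hadm) hwinU' hsep' τ hτ δ hδ hδ0 (fun n => ![v n 0, -v n 1]) hv' hvx'
    -- carry the conclusion back: density and profile are reflection-invariant
    have hdens : ∀ n, closureDensity R' (δ n) (![v n 0, -v n 1] : Site 2) = closureDensity R (δ n) (v n) :=
      fun n => stub_conjDensity R R' ⟨hcar, hbdy, hmark⟩ (δ n) (v n)
    simp_rw [hdens] at key
    have hderiv : ‖deriv w' (R'.boundary τ)‖ = ‖deriv w (R.boundary τ)‖ := by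
      have hτU : R.boundary τ ∈ U := hwinU ⟨τ, hτ, rfl⟩
      rw [hbdy, hw'deriv _ (by rw [Complex.conj_conj]; exact hτU), Complex.conj_conj, norm_neg,
        Complex.norm_conj]
    have hnorm : ∀ i, ‖w' (R'.boundary τ) - w' (R'.pt i)‖ = ‖w (R.boundary τ) - w (R.pt i)‖ := fun i => by
      rw [hval', hvalpt']
      have : -(starRingEnd ℂ) (w (R.boundary τ)) - -(starRingEnd ℂ) (w (R.pt i)) =
          (starRingEnd ℂ) (w (R.pt i) - w (R.boundary τ)) := by
        rw [map_sub]; ring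
      rw [this, Complex.norm_conj, norm_sub_rev]
    simpa only [hderiv, hnorm] using key

end Summit.CriticalPhenomena.CardyFormulaZ2.Cruxes.RectilinearCardy.ExcursionKernelCovariance

end
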